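import Literature.AlgebraicGeometry.Motives.LinearSectionNetBertini
import Literature.AlgebraicGeometry.Motives.LinearSectionNet
import Literature.AlgebraicGeometry.Motives.FamiliesVHS
import Literature.AlgebraicGeometry.Motives.ProjectiveSpaceFieldPoints
import HarnessLib

/-!
# A good pencil through a prescribed regular hyperplane section (Bertini) — named fact

Family `hodge`, layer `Literature/AlgebraicGeometry/Motives`. Requested by crux `stmt-HodgeConjecture-1076`, line
`polar-patch-broken-cycles`, stub `stub_thomasDescentOfSweep` (Thomas's hyperplane descent): the extra Bertini input of its
`H`-direction — a hyperplane section `X ∩ V₊(ℓ)` which is a regular cut extends to a PENCIL `(ℓ, ℓ')` with smooth projective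
total space whose map to `ℙ¹` is smooth of the right relative dimension over a neighbourhood of `[0:1]` (the tree's
`exists_goodPencil` is not flexible enough: its pencil and its discriminant are existential). Classical (Bertini,
Hartshorne II 8.18; flatness over the Dedekind `ℙ¹`, III 9.7; smoothness at a smooth fibre, III 10.2); NOT in the tree.
Statement drafted by the S4 planning worker of the line lead (2026-08-17).
-/

noncomputable section

open CategoryTheory CategoryTheory.Limits AlgebraicGeometry MonoidalCategory

namespace Literature.AlgebraicGeometry.Motives

/-- **A good pencil through a prescribed regular hyperplane section** (the extra Bertini input
of the `H`-direction of Thomas's hyperplane descent, Thomas 2005 §5; `exists_goodPencil` is NOT flexible enough: its pencil and its discriminant are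
existential). For `X ↪ ℙᴺ` smooth projective of dimension `m + 1 ≥ 2` and a linear form `ℓ = a₁ 0`
which is a regular cut of `X` (Bertini property at the closed points of `X ∩ V₊(ℓ)`), there is a
second form making `a = (ℓ, ℓ')` a pencil with smooth projective total space `X̃` of dimension
`m + 1` whose map `π : X̃ ⟶ ℙ¹` is smooth of relative dimension `m` over an open `V ∋ [0:1]` all of
whose members are smooth projective `m`-folds — the member over `[0:1]` being `X ∩ V₊(ℓ)`
(`HodgeTheory.range_map_fiberι_blowDown`). Proof sketch: generic `ℓ'` keeps the Bertini property
(`LinearSectionNet.isGeneric_regularCut_snoc`), so `GoodCentre` (`goodCentre_of_regularCut`), `X̃`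
smooth projective (`isSmoothProjective_total`), `π` proper with geometrically connected fibres
(`geometricallyConnected_proj_left`: the base locus `X ∩ V(ℓ, ℓ')` is non-empty for `dim X ≥ 2`, as
in `exists_goodCentre`); `π` is flat (`X̃` integral over the Dedekind `ℙ¹`, Hartshorne III 9.7) with
smooth fibre `X ∩ V₊(ℓ)` over `[0:1]`, hence smooth at the points of that fibre (Stacks 01V8) and, `π`
being closed, smooth over a neighbourhood `V` of `[0:1]`
(`UniversalHyperplaneSection.exists_smoothOfRelativeDimension_morphismRestrict_of_forall`), of relative
dimension `m` (`FiberNet.smoothOfRelativeDimension_morphismRestrict_of_isSmoothProjective`); members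
over `V` are smooth projective `m`-folds (`FiberNet.isSmoothProjective_fiber_of_mem_smoothBase`).
[cite: Hartshorne1977, II Thm. 8.18, III Prop. 9.7 and III Thm. 10.2] [cite: VoisinHodgeII2003, §2.1.1]
[cite: Thomas2005Nodes, §5] -/
def pencil_through_regularHyperplaneSection : Prop :=
  ∀ ⦃m N : ℕ⦄ ⦃X : SchemeOver ℂ⦄, IsSmoothProjective (m + 1) X → 1 ≤ m →
    ∀ (ι : X ⟶ projectiveSpace N ℂ) [IsClosedImmersion ι.left] (a₁ : Fin 1 → Fin (N + 1) → ℂ),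
      LinearSectionNet.RegularCut ι a₁ →
      ∃ (a : Fin (1 + 1) → Fin (N + 1) → ℂ) (V : (projectiveSpace 1 ℂ).left.Opens),
        a 0 = a₁ 0 ∧ a ≠ 0 ∧ IsSmoothProjective (m + 1) (LinearSectionNet.total ι a) ∧
        (ProjectiveSpace.pointOfVec ℂ (![0, 1] : Fin (1 + 1) → ℂ) (by simp)).pt ∈ V ∧
        SmoothOfRelativeDimension m ((LinearSectionNet.proj ι a).left ∣_ V) ∧
        ∀ t : ComplexPoints (projectiveSpace 1 ℂ), t.pt ∈ V →
          IsSmoothProjective m (fiberOver (LinearSectionNet.proj ι a) t)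


end Literature.AlgebraicGeometry.Motives

end
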